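import Summits.CriticalPhenomena.SAWScalingLimit.Theorems.SAWMassiveIsingTiltCornerTransfer

/-!
# `SAWMassiveIsingTilt.Assembly` (stmt-CriticalPhenomena-15220) — proved

Route `SAWMassiveIsingTilt` of `CriticalPhenomena/SAWScalingLimit`, assembly item (rank 1), in its
content-bearing form (route rev 4, ground repair 2026-08-16):

`MassiveWindowSLE → CriticalCurveContinuity → CornerLaw → HexEndpointApproxExists →
 LatticeUniversality → SAWScalingLimit`.

The pure-glue support `CornerTransfer` (`CornerLaw → HexEndpointApproxExists →
OneClassOnCriticalCurve → LatticeUniversality → SAWScalingLimit`, stmt-CriticalPhenomena-9865) is NOT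
an antecedent any more; it is carried inside by the landed theorem `CornerTransfer_proof` of
`Theorems/SAWMassiveIsingTiltCornerTransfer.lean`. The proof is therefore three lines:
`CriticalCurveContinuity` (which unfolds to `MassiveWindowSLE → OneClassOnCriticalCurve`) applied to
`MassiveWindowSLE` gives the target `OneClassOnCriticalCurve`, and `CornerTransfer_proof` consumes
`CornerLaw`, `HexEndpointApproxExists`, the target and `LatticeUniversality`. (The rev-2 version of
this file proved the superseded 6-antecedent form stmt-CriticalPhenomena-10351, with `CornerTransfer`
as a hypothesis; it stopped elaborating when `Assembly` was restated and is replaced here.)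

## References

* G. F. Lawler, O. Schramm, W. Werner, *Conformal restriction: the chordal case*, J. Amer. Math.
  Soc. 16 (2003) — the identification step behind `MassiveWindowSLE` (not used in this file).
* H. Duminil-Copin, S. Smirnov, *The connective constant of the honeycomb lattice equals
  `√(2+√2)`*, Ann. of Math. 175 (2012), §4, Conjecture 1.
-/

open Summit.CriticalPhenomena.SAWScalingLimit.Theses.SAWMassiveIsingTilt

namespace Summit.CriticalPhenomena.SAWScalingLimit.Theorems

/-- **`SAWMassiveIsingTilt.Assembly` (stmt-CriticalPhenomena-15220) holds**:
`MassiveWindowSLE → CriticalCurveContinuity → CornerLaw → HexEndpointApproxExists →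
LatticeUniversality → SAWScalingLimit`: the target `OneClassOnCriticalCurve` is
`CriticalCurveContinuity` applied to `MassiveWindowSLE`, and the landed corner transfer
`CornerTransfer_proof` (`CornerLaw → HexEndpointApproxExists → OneClassOnCriticalCurve →
LatticeUniversality → SAWScalingLimit`) carries `CornerLaw`, `HexEndpointApproxExists`, the target
and `LatticeUniversality` to the summit statement `SAWScalingLimit`. -/
theorem massiveIsingTilt_assembly_proof :
    Summit.CriticalPhenomena.SAWScalingLimit.Theses.SAWMassiveIsingTilt.Assembly := by
  unfold Summit.CriticalPhenomena.SAWScalingLimit.Theses.SAWMassiveIsingTilt.Assembly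
  intro hMW hCC hCL hHE hLU
  exact CornerTransfer_proof hCL hHE (hCC hMW) hLU

end Summit.CriticalPhenomena.SAWScalingLimit.Theorems
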